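import Literature.MathematicalPhysics.KineticTheory.LangevinChainConfined
import Literature.MathematicalPhysics.KineticTheory.SiteDependentOscillatorChain
import HarnessLib

/-!
# Site-inhomogeneous Langevin chains with confining potentials: drift, energy balance, confined drift

Topic `Literature/MathematicalPhysics/KineticTheory`, grouping namespace `…KineticTheory.HeatConduction`.
Twin, for the SITE-DEPENDENT chains `SiteChain` of `CellChain.lean` (pinning `U i`, bond potential
`V i` on the bond `(i, i+1)`, one bath coupling `γ` at the sites `0` and `N - 1`: the oscillator
NETWORK of Cuneo–Eckmann–Hairer–Rey-Bellet on the path graph, Bonetto–Lebowitz–Rey-Bellet's crystal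
(8) with site-dependent data), of the first half of `LangevinChainConfined.lean`, which does the
same for the homogeneous `OscillatorChain`. The equations of motion (BLR eq. (10), CEHRB eq. (2.2))
are the additive-noise SDE

  `dz = Y(z) dt + v_L dB^L + v_R dB^R`,  `Y(q, p) = (p, -∇_q H - γ 1_B p)`,  `v_b = √(2γT_b) ∂_{p_b}`

on `PhaseSpace N`; this file supplies the deterministic input of the MODEL-FREE pipeline
`ConfinedForcedFlow → ConfinedDriftKernel → ConfinedFlowBounds → ConfinedGeneratorStep → ConfinedDynkin`:

* `SiteChain.partialP_hamiltonian` (`∂_{p_i}H = p_i`), `SiteChain.dPotential` (closed form of `∂_{q_i}H`,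
  `partialQ_hamiltonian_eq_dPotential`), the Langevin drift `SiteChain.langevinDrift`;
* the hypothesis structure `SiteChain.UniformlyConfining` — `U i, V i ∈ C²`, nonnegative,
  `|U_i'| ≤ A(1 + U_i)`, `|V_i'| ≤ B(1 + V_i)` with constants UNIFORM in the site, `γ ≥ 0`, and every
  `U i` growing at infinity (instances: every cell chain `cellChain ω₂ lam β γ c` with `ω₂ > 0`,
  `lam, β, γ ≥ 0`);
* the energy inequalities, the linear force bound `∑|∂_{q_i}H| ≤ N(A + N²B)(1 + H)`, and the energy
  shift under a momentum translation `H(q, p + e) - H(q, p) = ∑_i (p_i e_i + e_i²/2)`.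

The energy identity along the driven dynamics and the `RegularConfinedDrift` package are in
`SiteChainConfinedDrift.lean`; the transition kernels, Dynkin's identity and the semigroup in
`SiteChainLangevinKernel.lean`.

## References

* N. Cuneo, J.-P. Eckmann, M. Hairer, L. Rey-Bellet, *Non-equilibrium steady states for networks of
  oscillators*, Electron. J. Probab. **23** (2018) no. 55, §2 eq. (2.1)–(2.3), §3 eq. (3.2)–(3.3).
* F. Bonetto, J. L. Lebowitz, L. Rey-Bellet, *Fourier's law: a challenge to theorists* (2000), §3 eq. (8),
  §4.1 eq. (10).
* R. Khasminskii, *Stochastic Stability of Differential Equations* (2nd ed., 2012), Thm 3.5, §3.4.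

## Design choices

* Proofs are those of `LangevinChainConfined.lean` / `LangevinChainSDE.lean` / `LangevinChainGibbs.lean`
  with `P.U ↦ P.U i.val`, `P.V ↦ P.V i.val`; the generic phase-space calculus (`partialQ_eq_fderiv`,
  `clm_apply_eq_sum`, `unitQ/unitP`, `bathWeight`, `momentumSubspace`, `levelRadius`) is imported, not copied.
  Names differ from the `OscillatorChain` twins where both namespaces are opened together
  (`langevinDrift`, `UniformlyConfining`); coordinates are written `(q, p)` where that is shorter.
* `UniformlyConfining` asks for constants `A, B` uniform over ALL sites `i : ℕ` (one object serves every
  length `N`); only the sites `i < N` matter at length `N`, but the uniform form is what the cell chains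
  satisfy.
* NOT here: kernels/semigroup (next file), Lyapunov/H2 estimates, uniqueness, anything model-specific.
-/

noncomputable section

open MeasureTheory Filter Topology Set Metric
open scoped NNReal ENNReal ContDiff

namespace Literature.MathematicalPhysics.KineticTheory.HeatConduction

open Literature.MathematicalPhysics.KineticTheory

variable {N : ℕ}

namespace SiteChain

variable (P : SiteChain)

/-! ### `∂_{p_i}H = p_i`; closed form of `∂_{q_i}H` -/

/-- Kinetic/potential splitting `H(q, p) = ∑_i p_i²/2 + Φ(q)` with
`Φ(q) = ∑_i U_i(q_i) + ∑_{bonds} V_i(q_{i+1} - q_i)`. [folklore] -/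
theorem hamiltonian_eq_kinetic_add (N : ℕ) (q p : Fin N → ℝ) :
    P.hamiltonian N (q, p) = (∑ i, p i ^ 2 / 2) +
      ((∑ i, P.U i.val (q i)) + ∑ i : Fin N, ∑ j : Fin N,
        if j.val = i.val + 1 then P.V i.val (q j - q i) else 0) := by
  simp only [hamiltonian, Finset.sum_add_distrib]
  ring

/-- `∂_{p_i} H = p_i` as a line derivative at `(q, p)` (no hypothesis on the potentials). [folklore] -/
theorem hasLineDerivAt_hamiltonian_unitP (N : ℕ) (q p : Fin N → ℝ) (i : Fin N) :
    HasLineDerivAt ℝ (P.hamiltonian N) (p i) (q, p) ((0, Pi.single i 1) : PhaseSpace N) := by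
  unfold HasLineDerivAt
  have h : (fun t : ℝ => P.hamiltonian N ((q, p) + t • ((0, Pi.single i 1) : PhaseSpace N))) =
      fun t => (p i + t) ^ 2 / 2 +
        ((∑ k ∈ Finset.univ.erase i, p k ^ 2 / 2) + ((∑ k, P.U k.val (q k)) +
          ∑ k : Fin N, ∑ j : Fin N, if j.val = k.val + 1 then P.V k.val (q j - q k) else 0)) := by
    funext t
    have e1 : ((q, p) + t • ((0, Pi.single i 1) : PhaseSpace N)) =
        (q, Function.update p i (p i + t)) := by
      rw [← add_smul_single_eq_update]; ext j <;> simp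
    rw [e1, hamiltonian_eq_kinetic_add, ← Finset.add_sum_erase _ _ (Finset.mem_univ i),
      Function.update_self, add_assoc]
    congr 2
    exact Finset.sum_congr rfl fun k hk => by rw [Function.update_of_ne (Finset.ne_of_mem_erase hk)]
  rw [h]
  apply HasDerivAt.add_const
  have h1 : HasDerivAt (fun t : ℝ => p i + t) 1 0 := (hasDerivAt_id' (0 : ℝ)).const_add _
  refine ((h1.pow 2).div_const 2).congr_deriv ?_
  norm_num

/-- `∂_{p_i} H (q, p) = p_i`. [folklore] -/
theorem partialP_hamiltonian (N : ℕ) (q p : Fin N → ℝ) (i : Fin N) :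
    partialP i (P.hamiltonian N) (q, p) = p i := by
  rw [partialP_eq_lineDeriv]
  exact (P.hasLineDerivAt_hamiltonian_unitP N q p i).lineDeriv

/-- Closed form of the force component `∂Φ/∂q_i`:
`U_i'(q_i) + ∑_{l = k+1} V_k'(q_l - q_k) ([l = i] - [k = i])`, i.e.
`U_i'(q_i) + V_{i-1}'(q_i - q_{i-1}) - V_i'(q_{i+1} - q_i)` with the boundary terms absent at the
ends. [cite: BonettoLebowitzReyBellet2000, §4.1 eq. (10)] -/
def dPotential (N : ℕ) (i : Fin N) (q : Fin N → ℝ) : ℝ :=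
  deriv (P.U i.val) (q i) + ∑ k : Fin N, ∑ l : Fin N,
    if l.val = k.val + 1 then
      deriv (P.V k.val) (q l - q k) * ((if l = i then 1 else 0) - (if k = i then 1 else 0)) else 0

/-- **Closed form of `∂_{q_i} H`** for differentiable potentials: `∂_{q_i} H (q, p) = ∂Φ/∂q_i (q)`
(`SiteChain.partialQ_hamiltonian` of `SiteDependentOscillatorChain.lean`, factors commuted).
[folklore] -/
theorem partialQ_hamiltonian_eq_dPotential (hU : ∀ i, Differentiable ℝ (P.U i))
    (hV : ∀ i, Differentiable ℝ (P.V i)) (N : ℕ) (x : PhaseSpace N) (i : Fin N) :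
    partialQ i (P.hamiltonian N) x = P.dPotential N i x.1 := by
  rw [P.partialQ_hamiltonian hU hV i x]
  unfold dPotential
  congr 1
  refine Finset.sum_congr rfl fun k _ => Finset.sum_congr rfl fun l _ => ?_
  split_ifs <;> ring

/-- `∂_{q_i}H` depends on the positions only (differentiable potentials). [folklore] -/
theorem partialQ_hamiltonian_fst (hU : ∀ i, Differentiable ℝ (P.U i))
    (hV : ∀ i, Differentiable ℝ (P.V i)) (y : PhaseSpace N) (e : Fin N → ℝ) (i : Fin N) :
    partialQ i (P.hamiltonian N) (y.1, y.2 + e) = partialQ i (P.hamiltonian N) y := by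
  rw [P.partialQ_hamiltonian_eq_dPotential hU hV, P.partialQ_hamiltonian_eq_dPotential hU hV]

/-- `∂Φ/∂q_i ∈ C^n` for `C^{n+1}` potentials. [folklore] -/
theorem contDiff_dPotential_of_succ {n : WithTop ℕ∞} (hU : ∀ i, ContDiff ℝ (n + 1) (P.U i))
    (hV : ∀ i, ContDiff ℝ (n + 1) (P.V i)) (N : ℕ) (i : Fin N) : ContDiff ℝ n (P.dPotential N i) := by
  have hU' : ∀ m, ContDiff ℝ n (deriv (P.U m)) := fun m => (hU m).deriv'
  have hV' : ∀ m, ContDiff ℝ n (deriv (P.V m)) := fun m => (hV m).deriv'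
  have hq : ∀ m : Fin N, ContDiff ℝ n fun q : Fin N → ℝ => q m := fun m => contDiff_apply ℝ ℝ m
  unfold dPotential
  refine ((hU' i.val).comp (hq i)).add (ContDiff.sum fun k _ => ContDiff.sum fun l _ => ?_)
  by_cases hlk : l.val = k.val + 1
  · simp only [hlk, if_true]
    exact ((hV' k.val).comp ((hq l).sub (hq k))).mul contDiff_const
  · simp only [hlk, if_false]
    exact contDiff_const

/-- The Hamiltonian is as smooth as the potentials. [folklore] -/
theorem contDiff_hamiltonian (N : ℕ) {n : WithTop ℕ∞} (hU : ∀ i, ContDiff ℝ n (P.U i))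
    (hV : ∀ i, ContDiff ℝ n (P.V i)) : ContDiff ℝ n (P.hamiltonian N) := by
  unfold hamiltonian
  have hq : ∀ i : Fin N, ContDiff ℝ n fun x : PhaseSpace N => x.1 i := fun i =>
    (contDiff_apply ℝ ℝ i).comp contDiff_fst
  have hp : ∀ i : Fin N, ContDiff ℝ n fun x : PhaseSpace N => x.2 i := fun i =>
    (contDiff_apply ℝ ℝ i).comp contDiff_snd
  apply ContDiff.add
  · exact ContDiff.sum fun i _ => (((hp i).pow 2).div_const 2).add ((hU i.val).comp (hq i))
  · refine ContDiff.sum fun i _ => ContDiff.sum fun j _ => ?_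
    by_cases h : j.val = i.val + 1
    · simp only [h, if_true]
      exact (hV i.val).comp ((hq j).sub (hq i))
    · simp only [h, if_false]
      exact contDiff_const

/-- The Hamiltonian is continuous if the potentials are. [folklore] -/
theorem continuous_hamiltonian (N : ℕ) (hU : ∀ i, Continuous (P.U i)) (hV : ∀ i, Continuous (P.V i)) :
    Continuous (P.hamiltonian N) :=
  (P.contDiff_hamiltonian N (fun i => contDiff_zero.2 (hU i)) (fun i => contDiff_zero.2 (hV i))).continuous

/-! ### The Langevin drift -/

/-- The drift vector field `Y(q, p) = (p, -∇_q H - γ 1_B p)` of the Langevin system of the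
site-dependent chain: `dq_i = p_i dt`, `dp_i = (-∂_{q_i} H - γ ([i = 0] + [i = N-1]) p_i) dt + noise`
(CEHR (2.2) on the path graph with baths at both ends, BLR (10)). [cite: CuneoEckmannHairerReyBellet2018, eq. (2.2)] -/
def langevinDrift (N : ℕ) (x : PhaseSpace N) : PhaseSpace N :=
  (x.2, fun i => -partialQ i (P.hamiltonian N) x - P.γ * OscillatorChain.bathWeight N i * x.2 i)

/-- Closed form of the drift for differentiable potentials. [folklore] -/
theorem langevinDrift_eq (hU : ∀ i, Differentiable ℝ (P.U i)) (hV : ∀ i, Differentiable ℝ (P.V i)) (N : ℕ) :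
    P.langevinDrift N = fun x => (x.2, fun i => -P.dPotential N i x.1 - P.γ * OscillatorChain.bathWeight N i * x.2 i) := by
  funext x
  simp only [langevinDrift, P.partialQ_hamiltonian_eq_dPotential hU hV]

/-- **The Langevin drift is `C¹` for `C²` potentials.** [folklore] -/
theorem contDiff_one_langevinDrift (hU : ∀ i, ContDiff ℝ 2 (P.U i)) (hV : ∀ i, ContDiff ℝ 2 (P.V i)) (N : ℕ) :
    ContDiff ℝ 1 (P.langevinDrift N) := by
  have h2 : (2 : WithTop ℕ∞) = 1 + 1 := by norm_num
  have hU1 : ∀ i, ContDiff ℝ (1 + 1) (P.U i) := fun i => h2 ▸ hU i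
  have hV1 : ∀ i, ContDiff ℝ (1 + 1) (P.V i) := fun i => h2 ▸ hV i
  have hUd : ∀ i, Differentiable ℝ (P.U i) := fun i => (hU i).differentiable (by norm_num)
  have hVd : ∀ i, Differentiable ℝ (P.V i) := fun i => (hV i).differentiable (by norm_num)
  rw [P.langevinDrift_eq hUd hVd]
  refine contDiff_snd.prodMk (contDiff_pi.2 fun i => ?_)
  exact (((P.contDiff_dPotential_of_succ hU1 hV1 N i).comp contDiff_fst).neg).sub
    (contDiff_const.mul ((contDiff_apply ℝ ℝ i).comp contDiff_snd))

/-! ### The hypothesis structure -/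

/-- **Uniformly confining potentials** for a site-dependent chain `P = (U i, V i, γ)`: all
`U i, V i ∈ C²` and nonnegative, derivatives dominated by the potentials with constants UNIFORM in the
site, `|U_i'(q)| ≤ A (1 + U_i(q))`, `|V_i'(r)| ≤ B (1 + V_i(r))`, nonnegative friction `γ ≥ 0`, and
every pinning growing at infinity, `U_i(q) → ∞` as `|q| → ∞`. Sitewise twin of
`OscillatorChain.IsConfining`; instances: the cell chains `cellChain ω₂ lam β γ c` (`ω₂ > 0`,
`lam, β, γ ≥ 0`). [folklore] -/
structure UniformlyConfining (P : SiteChain) : Prop where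
  contDiff_U : ∀ i, ContDiff ℝ 2 (P.U i)
  contDiff_V : ∀ i, ContDiff ℝ 2 (P.V i)
  γ_nonneg : 0 ≤ P.γ
  U_nonneg : ∀ i q, 0 ≤ P.U i q
  V_nonneg : ∀ i r, 0 ≤ P.V i r
  exists_abs_deriv_U_le : ∃ A : ℝ, 0 ≤ A ∧ ∀ i q, |deriv (P.U i) q| ≤ A * (1 + P.U i q)
  exists_abs_deriv_V_le : ∃ B : ℝ, 0 ≤ B ∧ ∀ i r, |deriv (P.V i) r| ≤ B * (1 + P.V i r)
  tendsto_U : ∀ i, Tendsto (P.U i) (cocompact ℝ) atTop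

/-! ### Energy inequalities for nonnegative potentials -/

/-- The interaction energy is nonnegative when all `V i ≥ 0`. [folklore] -/
theorem interaction_nonneg (hV0 : ∀ i r, 0 ≤ P.V i r) (N : ℕ) (q : Fin N → ℝ) :
    0 ≤ ∑ i : Fin N, ∑ j : Fin N, (if j.val = i.val + 1 then P.V i.val (q j - q i) else 0) :=
  Finset.sum_nonneg fun i _ => Finset.sum_nonneg fun j _ => by
    split_ifs
    · exact hV0 _ _
    · exact le_rfl

/-- Each site energy is dominated by the total energy: `p_i²/2 + U_i(q_i) ≤ H`. [folklore] -/
theorem site_le_hamiltonian (hU0 : ∀ i q, 0 ≤ P.U i q) (hV0 : ∀ i r, 0 ≤ P.V i r) (N : ℕ)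
    (x : PhaseSpace N) (i : Fin N) : x.2 i ^ 2 / 2 + P.U i.val (x.1 i) ≤ P.hamiltonian N x := by
  unfold hamiltonian
  have h1 : x.2 i ^ 2 / 2 + P.U i.val (x.1 i) ≤ ∑ k : Fin N, (x.2 k ^ 2 / 2 + P.U k.val (x.1 k)) :=
    Finset.single_le_sum (f := fun k : Fin N => x.2 k ^ 2 / 2 + P.U k.val (x.1 k))
      (fun k _ => add_nonneg (by positivity) (hU0 _ _)) (Finset.mem_univ i)
  have h2 := P.interaction_nonneg hV0 N x.1
  linarith

/-- The energy is nonnegative when all `U i, V i ≥ 0`. [folklore] -/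
theorem hamiltonian_nonneg_of_nonneg (hU0 : ∀ i q, 0 ≤ P.U i q) (hV0 : ∀ i r, 0 ≤ P.V i r) (N : ℕ)
    (x : PhaseSpace N) : 0 ≤ P.hamiltonian N x := by
  unfold hamiltonian
  exact add_nonneg (Finset.sum_nonneg fun k _ => add_nonneg (by positivity) (hU0 _ _))
    (P.interaction_nonneg hV0 N x.1)

/-- The kinetic energy is dominated by the total energy: `∑ p_i²/2 ≤ H`. [folklore] -/
theorem kinetic_le_hamiltonian_of_nonneg (hU0 : ∀ i q, 0 ≤ P.U i q) (hV0 : ∀ i r, 0 ≤ P.V i r)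
    (N : ℕ) (x : PhaseSpace N) : ∑ i, x.2 i ^ 2 / 2 ≤ P.hamiltonian N x := by
  unfold hamiltonian
  have h1 : ∑ i, x.2 i ^ 2 / 2 ≤ ∑ k : Fin N, (x.2 k ^ 2 / 2 + P.U k.val (x.1 k)) :=
    Finset.sum_le_sum fun k _ => le_add_of_nonneg_right (hU0 _ _)
  have h2 := P.interaction_nonneg hV0 N x.1
  linarith

/-- Each bond energy is dominated by the total energy: `V_k(q_l - q_k) ≤ H` for `l = k + 1`. [folklore] -/
theorem bond_le_hamiltonian (hU0 : ∀ i q, 0 ≤ P.U i q) (hV0 : ∀ i r, 0 ≤ P.V i r) (N : ℕ)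
    (x : PhaseSpace N) {k l : Fin N} (hlk : l.val = k.val + 1) :
    P.V k.val (x.1 l - x.1 k) ≤ P.hamiltonian N x := by
  unfold hamiltonian
  have h1 : 0 ≤ ∑ i : Fin N, (x.2 i ^ 2 / 2 + P.U i.val (x.1 i)) :=
    Finset.sum_nonneg fun i _ => add_nonneg (by positivity) (hU0 _ _)
  have hin : (if l.val = k.val + 1 then P.V k.val (x.1 l - x.1 k) else 0) ≤
      ∑ j : Fin N, (if j.val = k.val + 1 then P.V k.val (x.1 j - x.1 k) else 0) :=
    Finset.single_le_sum (f := fun j : Fin N => if j.val = k.val + 1 then P.V k.val (x.1 j - x.1 k) else 0)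
      (fun j _ => by
        split_ifs
        · exact hV0 _ _
        · exact le_rfl) (Finset.mem_univ l)
  rw [if_pos hlk] at hin
  have hout : ∑ j : Fin N, (if j.val = k.val + 1 then P.V k.val (x.1 j - x.1 k) else 0) ≤
      ∑ i : Fin N, ∑ j : Fin N, (if j.val = i.val + 1 then P.V i.val (x.1 j - x.1 i) else 0) :=
    Finset.single_le_sum
      (f := fun i : Fin N => ∑ j : Fin N, (if j.val = i.val + 1 then P.V i.val (x.1 j - x.1 i) else 0))
      (fun i _ => Finset.sum_nonneg fun j _ => by
        split_ifs
        · exact hV0 _ _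
        · exact le_rfl) (Finset.mem_univ k)
  linarith

/-- `∑_i |p_i| ≤ N/2 + H`. [folklore] -/
theorem sum_abs_momentum_le (hU0 : ∀ i q, 0 ≤ P.U i q) (hV0 : ∀ i r, 0 ≤ P.V i r) (N : ℕ)
    (x : PhaseSpace N) : ∑ i, |x.2 i| ≤ N / 2 + P.hamiltonian N x := by
  have h := P.kinetic_le_hamiltonian_of_nonneg hU0 hV0 N x
  calc ∑ i, |x.2 i| ≤ ∑ i : Fin N, (1 / 2 + x.2 i ^ 2 / 2) :=
        Finset.sum_le_sum fun i _ => abs_le_half_add_sq_half _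
    _ = N / 2 + ∑ i, x.2 i ^ 2 / 2 := by
        rw [Finset.sum_add_distrib]
        simp only [Finset.sum_const, Finset.card_univ, Fintype.card_fin, nsmul_eq_mul]
        ring
    _ ≤ N / 2 + P.hamiltonian N x := by linarith

/-- `∑_i p_i² ≤ 2H`. [folklore] -/
theorem sum_sq_momentum_le (hU0 : ∀ i q, 0 ≤ P.U i q) (hV0 : ∀ i r, 0 ≤ P.V i r) (N : ℕ)
    (x : PhaseSpace N) : ∑ i, x.2 i ^ 2 ≤ 2 * P.hamiltonian N x := by
  have h := P.kinetic_le_hamiltonian_of_nonneg hU0 hV0 N x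
  have h2 : ∑ i, x.2 i ^ 2 = 2 * ∑ i, x.2 i ^ 2 / 2 := by
    rw [Finset.mul_sum]
    exact Finset.sum_congr rfl fun i _ => by ring
  rw [h2]
  linarith

/-! ### The linear force bound `∑ |∂_{q_i}H| ≤ K (1 + H)` -/

/-- **The force is dominated by the energy**: if `|U_i'| ≤ A(1 + U_i)` and `|V_i'| ≤ B(1 + V_i)`
uniformly in the site (`A, B ≥ 0`, `U i, V i ≥ 0`) then `|∂Φ/∂q_i| ≤ (A + N² B)(1 + H)`. [folklore] -/
theorem abs_dPotential_le {A B : ℝ} (hA0 : 0 ≤ A) (hB0 : 0 ≤ B)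
    (hA : ∀ i q, |deriv (P.U i) q| ≤ A * (1 + P.U i q)) (hB : ∀ i r, |deriv (P.V i) r| ≤ B * (1 + P.V i r))
    (hU0 : ∀ i q, 0 ≤ P.U i q) (hV0 : ∀ i r, 0 ≤ P.V i r) (N : ℕ) (x : PhaseSpace N) (i : Fin N) :
    |P.dPotential N i x.1| ≤ (A + N ^ 2 * B) * (1 + P.hamiltonian N x) := by
  set H := P.hamiltonian N x with hH
  have hH0 : 0 ≤ H := P.hamiltonian_nonneg_of_nonneg hU0 hV0 N x
  unfold dPotential
  refine (abs_add_le _ _).trans ?_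
  have h1 : |deriv (P.U i.val) (x.1 i)| ≤ A * (1 + H) := by
    refine (hA _ _).trans (mul_le_mul_of_nonneg_left ?_ hA0)
    have := P.site_le_hamiltonian hU0 hV0 N x i
    nlinarith [sq_nonneg (x.2 i)]
  have hkl : ∀ k l : Fin N, |(if l.val = k.val + 1 then
      deriv (P.V k.val) (x.1 l - x.1 k) * ((if l = i then 1 else 0) - (if k = i then 1 else 0)) else 0)| ≤
      B * (1 + H) := by
    intro k l
    have hs : |((if l = i then (1 : ℝ) else 0) - (if k = i then 1 else 0))| ≤ 1 := by
      split_ifs <;> norm_num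
    have hnn : 0 ≤ B * (1 + H) := mul_nonneg hB0 (by linarith)
    by_cases hlk : l.val = k.val + 1
    · rw [if_pos hlk, abs_mul]
      have hV' : |deriv (P.V k.val) (x.1 l - x.1 k)| ≤ B * (1 + H) :=
        (hB _ _).trans (mul_le_mul_of_nonneg_left
          (by linarith [P.bond_le_hamiltonian hU0 hV0 N x hlk]) hB0)
      calc |deriv (P.V k.val) (x.1 l - x.1 k)| * |((if l = i then (1 : ℝ) else 0) - (if k = i then 1 else 0))|
          ≤ B * (1 + H) * 1 := mul_le_mul hV' hs (abs_nonneg _) hnn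
        _ = B * (1 + H) := mul_one _
    · rw [if_neg hlk, abs_zero]
      exact hnn
  have h2 : |∑ k : Fin N, ∑ l : Fin N, (if l.val = k.val + 1 then
      deriv (P.V k.val) (x.1 l - x.1 k) * ((if l = i then 1 else 0) - (if k = i then 1 else 0)) else 0)| ≤
      N ^ 2 * B * (1 + H) := by
    refine (Finset.abs_sum_le_sum_abs _ _).trans ?_
    calc ∑ k : Fin N, |∑ l : Fin N, (if l.val = k.val + 1 then
          deriv (P.V k.val) (x.1 l - x.1 k) * ((if l = i then 1 else 0) - (if k = i then 1 else 0)) else 0)|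
        ≤ ∑ k : Fin N, ∑ l : Fin N, B * (1 + H) :=
          Finset.sum_le_sum fun k _ => (Finset.abs_sum_le_sum_abs _ _).trans
            (Finset.sum_le_sum fun l _ => hkl k l)
      _ = N ^ 2 * B * (1 + H) := by simp; ring
  nlinarith

/-- **The linear force bound**: `∑_i |∂_{q_i}H(x)| ≤ N (A + N² B)(1 + H(x))`. [folklore] -/
theorem sum_abs_partialQ_hamiltonian_le {A B : ℝ} (hA0 : 0 ≤ A) (hB0 : 0 ≤ B)
    (hA : ∀ i q, |deriv (P.U i) q| ≤ A * (1 + P.U i q)) (hB : ∀ i r, |deriv (P.V i) r| ≤ B * (1 + P.V i r))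
    (hU0 : ∀ i q, 0 ≤ P.U i q) (hV0 : ∀ i r, 0 ≤ P.V i r) (hUd : ∀ i, Differentiable ℝ (P.U i))
    (hVd : ∀ i, Differentiable ℝ (P.V i)) (N : ℕ) (x : PhaseSpace N) :
    ∑ i, |partialQ i (P.hamiltonian N) x| ≤ N * (A + N ^ 2 * B) * (1 + P.hamiltonian N x) := by
  calc ∑ i, |partialQ i (P.hamiltonian N) x|
      ≤ ∑ _i : Fin N, (A + N ^ 2 * B) * (1 + P.hamiltonian N x) :=
        Finset.sum_le_sum fun i _ => by
          rw [P.partialQ_hamiltonian_eq_dPotential hUd hVd]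
          exact P.abs_dPotential_le hA0 hB0 hA hB hU0 hV0 N x i
    _ = N * (A + N ^ 2 * B) * (1 + P.hamiltonian N x) := by simp; ring

/-! ### The energy shift under a momentum translation -/

/-- **The energy shift under a momentum translation**: `H(q, p + e) - H(q, p) = ∑_i (p_i e_i + e_i²/2)`.
[folklore] -/
theorem hamiltonian_momentum_shift (N : ℕ) (q p e : Fin N → ℝ) :
    P.hamiltonian N (q, p + e) - P.hamiltonian N (q, p) = ∑ i, (p i * e i + e i ^ 2 / 2) := by
  rw [P.hamiltonian_eq_kinetic_add, P.hamiltonian_eq_kinetic_add]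
  simp only [Pi.add_apply, add_sub_add_right_eq_sub, ← Finset.sum_sub_distrib]
  exact Finset.sum_congr rfl fun i _ => by ring

/-- `|H(q, p + e) - H(q, p)| ≤ ‖e‖ (∑|p_i| + N/2)` for `‖e‖ ≤ 1`. [folklore] -/
theorem abs_hamiltonian_momentum_shift_le (N : ℕ) (q p : Fin N → ℝ) {e : Fin N → ℝ}
    (he : ‖e‖ ≤ 1) :
    |P.hamiltonian N (q, p + e) - P.hamiltonian N (q, p)| ≤ ‖e‖ * ((∑ i, |p i|) + N / 2) := by
  rw [P.hamiltonian_momentum_shift]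
  refine (Finset.abs_sum_le_sum_abs _ _).trans ?_
  have hei : ∀ i, |e i| ≤ ‖e‖ := fun i => by rw [← Real.norm_eq_abs]; exact norm_le_pi_norm e i
  have h0 : 0 ≤ ‖e‖ := norm_nonneg _
  calc ∑ i, |p i * e i + e i ^ 2 / 2| ≤ ∑ i, (‖e‖ * |p i| + ‖e‖ * (1 / 2)) :=
        Finset.sum_le_sum fun i _ => by
          refine (abs_add_le _ _).trans (add_le_add ?_ ?_)
          · rw [abs_mul, mul_comm]
            exact mul_le_mul_of_nonneg_right (hei i) (abs_nonneg _)
          · rw [abs_of_nonneg (by positivity)]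
            have h1 : e i ^ 2 ≤ ‖e‖ ^ 2 := by
              rw [← sq_abs]
              exact pow_le_pow_left₀ (abs_nonneg _) (hei i) 2
            nlinarith
    _ = ‖e‖ * ((∑ i, |p i|) + N / 2) := by
        rw [Finset.sum_add_distrib, ← Finset.mul_sum]
        simp only [Finset.sum_const, Finset.card_univ, Fintype.card_fin, nsmul_eq_mul]
        ring

end SiteChain

end Literature.MathematicalPhysics.KineticTheory.HeatConduction
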